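import Mathlib

/-!
# Route BarrierLever — item `PartitionMinorsHitByVP` (stmt-ValiantsHypothesis-19717), line `hidden-states`:
# BALL-DIAGONAL III — the face-poset system: `det [B_E(F_q)] = ±1` in kernel form (PROOF-balldiagonal §3)

Helper file (`--supports stmt-ValiantsHypothesis-19717`; cell valiant-natproofs, rung V4, 𝒟-side door (c), registered line
`Cruxes/PartitionMinorsHitByVP/Lines/hidden_states.lean` v8; prover seat val-np-p6 gen 13). Definition-free; closes NO item.

CONTEXT (HOME/val-np-p6/g12/PROOF-balldiagonal-p6g12.md §2–3). After the block elimination, the nonsingularity of the ball `B_{h−2}`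
against a down-set of co-size `h + 1` with core `C` and missing complex `𝔈` (a family of `|C|` subsets of the non-core block, each of size
`≥ 2`, closed under sub-faces of size `≥ 2`) reduces to an `s × s` linear system in the unknowns `κ_q` (`q ∈ C`):
`Σ_{q ∈ C} κ_q · B_E(q) = 0` for every `E ∈ 𝔈`, where for the σ-table (`λ_q = 1_{F q}`, `Λ = d`, `μ_q = d − 1_{F q}`)
`B_E(q) = ∏_{a∈E} (d_a − [a ∈ F q]) − ∏_{a∈E} d_a + Σ_{z∈E} [z ∈ F q] ∏_{a ∈ E∖z} d_a`.

* `bEntry_eq_sum_faces` — inclusion–exclusion: `B_E(q) = Σ_{G ⊆ E, |G| ≥ 2} (−1)^{|G|} [G ⊆ F q] ∏_{a ∈ E∖G} d_a` (PROOF §3: `B = Y · W`,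
  `Y` the zeta matrix of the face poset, `W` triangular with diagonal `(−1)^{|E|}`);
* **`facePoset_kernel`** — if `F` maps `C` injectively into `𝔈` then the system has only the trivial solution: the face sums
  `ν(G) = Σ_q κ_q [G ⊆ F q]` die by induction up the face poset (closure under sub-faces), then `κ_q = ν(F q) − (larger faces)` dies by
  induction down the sizes `|F q|`. The weights `d` are arbitrary complex numbers (in the application `d_a = #{c : a ∈ F c}`).

WHAT THIS IS NOT: one linear-algebra brick of the ball-diagonal theorem; nothing on crux 14610 or VP ≠ VNP.
-/

set_option linter.dupNamespace false

namespace Summit.ValiantsHypothesis.ValiantsHypothesis.Theorems.BarrierLever.HiddenStates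

open Finset

noncomputable section

namespace BallDiag

variable {α : Type*} [DecidableEq α]

/-- The subsets of `E` of size `< 2` are `∅` and the singletons: a sum over them. -/
theorem sum_powerset_card_lt_two (E : Finset α) (f : Finset α → ℂ) :
    ∑ G ∈ E.powerset with ¬ 2 ≤ G.card, f G = f ∅ + ∑ z ∈ E, f {z} := by
  have hset : E.powerset.filter (fun G => ¬ 2 ≤ G.card) = insert ∅ (E.image fun z => ({z} : Finset α)) := by
    ext G
    simp only [Finset.mem_filter, Finset.mem_powerset, Finset.mem_insert, Finset.mem_image, not_le]
    constructor
    · rintro ⟨hGE, hG⟩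
      rcases Nat.lt_or_ge G.card 1 with h0 | h1
      · left
        have hG0 : G.card = 0 := by omega
        exact Finset.card_eq_zero.mp hG0
      · right
        have hG1 : G.card = 1 := by omega
        obtain ⟨z, rfl⟩ := Finset.card_eq_one.mp hG1
        exact ⟨z, hGE (Finset.mem_singleton_self z), rfl⟩
    · rintro (rfl | ⟨z, hz, rfl⟩)
      · exact ⟨Finset.empty_subset E, by simp⟩
      · exact ⟨Finset.singleton_subset_iff.mpr hz, by simp⟩
  rw [hset, Finset.sum_insert, Finset.sum_image]
  · intro z _ z' _ h
    exact Finset.singleton_injective h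
  · intro h
    obtain ⟨z, -, hz⟩ := Finset.mem_image.mp h
    exact Finset.singleton_ne_empty z hz

/-- **Inclusion–exclusion for the entries `B_E(q)`.**
`∏_{a∈E} (d_a − [a ∈ Fq]) − ∏_{a∈E} d_a + Σ_{z∈E} [z ∈ Fq] ∏_{a∈E∖z} d_a = Σ_{G ⊆ E, |G| ≥ 2} (−1)^{|G|} [G ⊆ Fq] ∏_{a∈E∖G} d_a`. -/
theorem bEntry_eq_sum_faces (E Fq : Finset α) (d : α → ℂ) :
    (∏ a ∈ E, (d a - if a ∈ Fq then 1 else 0)) - (∏ a ∈ E, d a)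
        + ∑ z ∈ E, (if z ∈ Fq then (1 : ℂ) else 0) * ∏ a ∈ E.erase z, d a
      = ∑ G ∈ E.powerset with 2 ≤ G.card,
          (-1 : ℂ) ^ G.card * (if G ⊆ Fq then 1 else 0) * ∏ a ∈ E \ G, d a := by
  -- binomial expansion of the first product
  have hind : ∀ G : Finset α, ∏ a ∈ G, (-(if a ∈ Fq then (1 : ℂ) else 0))
      = (-1 : ℂ) ^ G.card * (if G ⊆ Fq then 1 else 0) := by
    intro G
    have h1 : ∀ a ∈ G, (-(if a ∈ Fq then (1 : ℂ) else 0)) = (-1) * (if a ∈ Fq then (1 : ℂ) else 0) := by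
      intro a _; ring
    rw [Finset.prod_congr rfl h1, Finset.prod_mul_distrib, Finset.prod_const, Finset.prod_boole]
    by_cases h : G ⊆ Fq
    · rw [if_pos h, if_pos (fun a ha => h ha)]
    · rw [if_neg h, if_neg (fun h' => h (fun a ha => h' a ha))]
  have hexp : ∏ a ∈ E, (d a - if a ∈ Fq then 1 else 0)
      = ∑ G ∈ E.powerset, (-1 : ℂ) ^ G.card * (if G ⊆ Fq then 1 else 0) * ∏ a ∈ E \ G, d a := by
    have h1 : ∀ a ∈ E, (d a - if a ∈ Fq then (1 : ℂ) else 0) = (-(if a ∈ Fq then (1 : ℂ) else 0)) + d a := by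
      intro a _; ring
    rw [Finset.prod_congr rfl h1, Finset.prod_add]
    exact Finset.sum_congr rfl fun G _ => by rw [hind]
  rw [hexp, ← Finset.sum_filter_add_sum_filter_not E.powerset (fun G => 2 ≤ G.card), sum_powerset_card_lt_two]
  -- the terms of size `0` and `1`
  have h0 : (-1 : ℂ) ^ (∅ : Finset α).card * (if (∅ : Finset α) ⊆ Fq then 1 else 0) * ∏ a ∈ E \ ∅, d a
      = ∏ a ∈ E, d a := by
    simp
  have h1 : ∀ z ∈ E, (-1 : ℂ) ^ ({z} : Finset α).card * (if ({z} : Finset α) ⊆ Fq then 1 else 0) * ∏ a ∈ E \ {z}, d a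
      = -((if z ∈ Fq then (1 : ℂ) else 0) * ∏ a ∈ E.erase z, d a) := by
    intro z _
    rw [Finset.card_singleton, pow_one, Finset.sdiff_singleton_eq_erase]
    simp only [Finset.singleton_subset_iff]
    ring
  rw [h0, Finset.sum_congr rfl h1, Finset.sum_neg_distrib]
  ring

/-- **THE FACE-POSET SYSTEM HAS ONLY THE TRIVIAL SOLUTION** (`det [B_E(F_q)] = ±1`, kernel form). See the module docstring. -/
theorem facePoset_kernel (C : Finset α) (𝔈 : Finset (Finset α)) (h𝔈2 : ∀ E ∈ 𝔈, 2 ≤ E.card)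
    (hclosed : ∀ E ∈ 𝔈, ∀ G, G ⊆ E → 2 ≤ G.card → G ∈ 𝔈)
    (F : α → Finset α) (hF𝔈 : ∀ c ∈ C, F c ∈ 𝔈) (hFinj : ∀ c ∈ C, ∀ c' ∈ C, F c = F c' → c = c')
    (d : α → ℂ) (κ : α → ℂ)
    (hκ : ∀ E ∈ 𝔈, ∑ q ∈ C, κ q *
      ((∏ a ∈ E, (d a - if a ∈ F q then 1 else 0)) - (∏ a ∈ E, d a)
        + ∑ z ∈ E, (if z ∈ F q then (1 : ℂ) else 0) * ∏ a ∈ E.erase z, d a) = 0) :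
    ∀ q ∈ C, κ q = 0 := by
  -- the face sums `ν G = Σ_q κ_q [G ⊆ F q]` satisfy a triangular system
  have hsys : ∀ E ∈ 𝔈, ∑ G ∈ E.powerset with 2 ≤ G.card,
      (-1 : ℂ) ^ G.card * (∏ a ∈ E \ G, d a) * ∑ q ∈ C, κ q * (if G ⊆ F q then 1 else 0) = 0 := by
    intro E hE
    have h1 := hκ E hE
    rw [Finset.sum_congr rfl fun q _ => by rw [bEntry_eq_sum_faces E (F q) d, Finset.mul_sum], Finset.sum_comm] at h1
    have h2 : ∑ G ∈ E.powerset with 2 ≤ G.card,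
        (-1 : ℂ) ^ G.card * (∏ a ∈ E \ G, d a) * ∑ q ∈ C, κ q * (if G ⊆ F q then 1 else 0)
        = ∑ G ∈ E.powerset with 2 ≤ G.card, ∑ q ∈ C,
            κ q * ((-1 : ℂ) ^ G.card * (if G ⊆ F q then 1 else 0) * ∏ a ∈ E \ G, d a) := by
      refine Finset.sum_congr rfl fun G _ => ?_
      rw [Finset.mul_sum]
      exact Finset.sum_congr rfl fun q _ => by ring
    rw [h2]
    exact h1
  -- ν vanishes on 𝔈, by induction up the face poset
  have hν : ∀ G ∈ 𝔈, ∑ q ∈ C, κ q * (if G ⊆ F q then 1 else 0) = 0 := by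
    intro G
    induction G using Finset.strongInduction with
    | H G ih =>
      intro hG
      have h1 := hsys G hG
      have hGmem : G ∈ G.powerset.filter (fun G' => 2 ≤ G'.card) :=
        Finset.mem_filter.mpr ⟨Finset.mem_powerset.mpr (subset_refl G), h𝔈2 G hG⟩
      rw [← Finset.add_sum_erase _ _ hGmem] at h1
      have hrest : ∑ G' ∈ (G.powerset.filter (fun G' => 2 ≤ G'.card)).erase G,
          (-1 : ℂ) ^ G'.card * (∏ a ∈ G \ G', d a) * ∑ q ∈ C, κ q * (if G' ⊆ F q then 1 else 0) = 0 := by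
        refine Finset.sum_eq_zero fun G' hG' => ?_
        obtain ⟨hne, hmem⟩ := Finset.mem_erase.mp hG'
        obtain ⟨hsub, hcard⟩ := Finset.mem_filter.mp hmem
        have hss : G' ⊂ G := lt_of_le_of_ne (Finset.mem_powerset.mp hsub) hne
        rw [ih G' hss (hclosed G hG G' hss.le hcard), mul_zero]
      rw [hrest, add_zero, Finset.sdiff_self, Finset.prod_empty, mul_one] at h1
      rcases mul_eq_zero.mp h1 with h | h
      · exact absurd h (pow_ne_zero _ (by norm_num))
      · exact h
  -- κ vanishes, by induction down the sizes |F q|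
  set M : ℕ := C.sup fun q => (F q).card with hM
  have hle : ∀ q ∈ C, (F q).card ≤ M := fun q hq => Finset.le_sup (f := fun q => (F q).card) hq
  have key : ∀ k : ℕ, ∀ q ∈ C, M - (F q).card = k → κ q = 0 := by
    intro k
    induction k using Nat.strong_induction_on with
    | _ k ih =>
      intro q hq hk
      have h1 := hν (F q) (hF𝔈 q hq)
      rw [← Finset.add_sum_erase _ _ hq, if_pos (subset_refl _), mul_one] at h1
      have hrest : ∑ q' ∈ C.erase q, κ q' * (if F q ⊆ F q' then 1 else 0) = 0 := by
        refine Finset.sum_eq_zero fun q' hq' => ?_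
        obtain ⟨hne, hq'C⟩ := Finset.mem_erase.mp hq'
        by_cases hsub : F q ⊆ F q'
        · have hne' : F q ≠ F q' := fun h => hne (hFinj q' hq'C q hq h.symm)
          have hlt : (F q).card < (F q').card := Finset.card_lt_card (lt_of_le_of_ne hsub hne')
          have := hle q' hq'C
          rw [ih (M - (F q').card) (by omega) q' hq'C rfl, zero_mul]
        · rw [if_neg hsub, mul_zero]
      rwa [hrest, add_zero] at h1
  intro q hq
  exact key _ q hq rfl

/-- **THE FACE-POSET SYSTEM WITH ONE FREE FACE** (for the second diagonal, co-size `h + 2`, memo val-np-p6 g13 §8γ). As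
`facePoset_kernel`, with one extra unknown `ξ` attached to a face `P₀ ∈ 𝔈` that is NOT in the image of `F`, entering the `E`-equation
through the term `(−1)^{|P₀|} [P₀ ⊆ E] ∏_{a ∈ E∖P₀} d_a` (the `W`-column of `P₀`): the system still has only the trivial solution
(the face sums absorb `ξ` at `G = P₀`; after `κ = 0` the `P₀`-sum returns `ξ = 0`). -/
theorem facePoset_kernel_insert (C : Finset α) (𝔈 : Finset (Finset α)) (h𝔈2 : ∀ E ∈ 𝔈, 2 ≤ E.card)
    (hclosed : ∀ E ∈ 𝔈, ∀ G, G ⊆ E → 2 ≤ G.card → G ∈ 𝔈)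
    (F : α → Finset α) (hF𝔈 : ∀ c ∈ C, F c ∈ 𝔈) (hFinj : ∀ c ∈ C, ∀ c' ∈ C, F c = F c' → c = c')
    (P₀ : Finset α) (hP₀ : P₀ ∈ 𝔈) (hFP₀ : ∀ c ∈ C, F c ≠ P₀)
    (d : α → ℂ) (κ : α → ℂ) (ξ : ℂ)
    (hκ : ∀ E ∈ 𝔈, ∑ q ∈ C, κ q *
      ((∏ a ∈ E, (d a - if a ∈ F q then 1 else 0)) - (∏ a ∈ E, d a)
        + ∑ z ∈ E, (if z ∈ F q then (1 : ℂ) else 0) * ∏ a ∈ E.erase z, d a)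
      + ξ * ((-1 : ℂ) ^ P₀.card * (if P₀ ⊆ E then 1 else 0) * ∏ a ∈ E \ P₀, d a) = 0) :
    (∀ q ∈ C, κ q = 0) ∧ ξ = 0 := by
  -- the perturbed face sums `ν' G = Σ_q κ_q [G ⊆ F q] + ξ [G = P₀]`
  have hsys : ∀ E ∈ 𝔈, ∑ G ∈ E.powerset with 2 ≤ G.card,
      (-1 : ℂ) ^ G.card * (∏ a ∈ E \ G, d a) *
        (∑ q ∈ C, κ q * (if G ⊆ F q then 1 else 0) + ξ * (if G = P₀ then 1 else 0)) = 0 := by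
    intro E hE
    have h1 := hκ E hE
    rw [Finset.sum_congr rfl fun q _ => by rw [bEntry_eq_sum_faces E (F q) d, Finset.mul_sum], Finset.sum_comm] at h1
    -- the `ξ`-term is the `G = P₀` summand
    have hξ : ξ * ((-1 : ℂ) ^ P₀.card * (if P₀ ⊆ E then 1 else 0) * ∏ a ∈ E \ P₀, d a)
        = ∑ G ∈ E.powerset with 2 ≤ G.card,
            (-1 : ℂ) ^ G.card * (∏ a ∈ E \ G, d a) * (ξ * (if G = P₀ then 1 else 0)) := by
      by_cases hsub : P₀ ⊆ E
      · have hmem : P₀ ∈ E.powerset.filter (fun G => 2 ≤ G.card) :=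
          Finset.mem_filter.mpr ⟨Finset.mem_powerset.mpr hsub, h𝔈2 P₀ hP₀⟩
        rw [Finset.sum_eq_single_of_mem P₀ hmem]
        · rw [if_pos hsub, if_pos rfl]; ring
        · intro G _ hG
          rw [if_neg hG, mul_zero, mul_zero]
      · rw [if_neg hsub, mul_zero, zero_mul, mul_zero]
        symm
        refine Finset.sum_eq_zero fun G hG => ?_
        rw [if_neg, mul_zero, mul_zero]
        rintro rfl
        exact hsub (Finset.mem_powerset.mp (Finset.mem_filter.mp hG).1)
    have h2 : ∑ G ∈ E.powerset with 2 ≤ G.card,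
        (-1 : ℂ) ^ G.card * (∏ a ∈ E \ G, d a) *
          (∑ q ∈ C, κ q * (if G ⊆ F q then 1 else 0) + ξ * (if G = P₀ then 1 else 0))
        = (∑ G ∈ E.powerset with 2 ≤ G.card, ∑ q ∈ C,
            κ q * ((-1 : ℂ) ^ G.card * (if G ⊆ F q then 1 else 0) * ∏ a ∈ E \ G, d a))
          + ∑ G ∈ E.powerset with 2 ≤ G.card,
            (-1 : ℂ) ^ G.card * (∏ a ∈ E \ G, d a) * (ξ * (if G = P₀ then 1 else 0)) := by
      rw [← Finset.sum_add_distrib]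
      refine Finset.sum_congr rfl fun G _ => ?_
      rw [mul_add, Finset.mul_sum]
      congr 1
      exact Finset.sum_congr rfl fun q _ => by ring
    rw [h2, ← hξ]
    exact h1
  -- ν' vanishes on 𝔈
  have hν : ∀ G ∈ 𝔈, ∑ q ∈ C, κ q * (if G ⊆ F q then 1 else 0) + ξ * (if G = P₀ then 1 else 0) = 0 := by
    intro G
    induction G using Finset.strongInduction with
    | H G ih =>
      intro hG
      have h1 := hsys G hG
      have hGmem : G ∈ G.powerset.filter (fun G' => 2 ≤ G'.card) :=
        Finset.mem_filter.mpr ⟨Finset.mem_powerset.mpr (subset_refl G), h𝔈2 G hG⟩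
      rw [← Finset.add_sum_erase _ _ hGmem] at h1
      have hrest : ∑ G' ∈ (G.powerset.filter (fun G' => 2 ≤ G'.card)).erase G,
          (-1 : ℂ) ^ G'.card * (∏ a ∈ G \ G', d a) *
            (∑ q ∈ C, κ q * (if G' ⊆ F q then 1 else 0) + ξ * (if G' = P₀ then 1 else 0)) = 0 := by
        refine Finset.sum_eq_zero fun G' hG' => ?_
        obtain ⟨hne, hmem⟩ := Finset.mem_erase.mp hG'
        obtain ⟨hsub, hcard⟩ := Finset.mem_filter.mp hmem
        have hss : G' ⊂ G := lt_of_le_of_ne (Finset.mem_powerset.mp hsub) hne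
        rw [ih G' hss (hclosed G hG G' hss.le hcard), mul_zero]
      rw [hrest, add_zero, Finset.sdiff_self, Finset.prod_empty, mul_one] at h1
      rcases mul_eq_zero.mp h1 with h | h
      · exact absurd h (pow_ne_zero _ (by norm_num))
      · exact h
  -- κ vanishes (the faces `F q` avoid `P₀`)
  set M : ℕ := C.sup fun q => (F q).card with hM
  have hle : ∀ q ∈ C, (F q).card ≤ M := fun q hq => Finset.le_sup (f := fun q => (F q).card) hq
  have key : ∀ k : ℕ, ∀ q ∈ C, M - (F q).card = k → κ q = 0 := by
    intro k
    induction k using Nat.strong_induction_on with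
    | _ k ih =>
      intro q hq hk
      have h1 := hν (F q) (hF𝔈 q hq)
      rw [if_neg (hFP₀ q hq), mul_zero, add_zero, ← Finset.add_sum_erase _ _ hq, if_pos (subset_refl _), mul_one] at h1
      have hrest : ∑ q' ∈ C.erase q, κ q' * (if F q ⊆ F q' then 1 else 0) = 0 := by
        refine Finset.sum_eq_zero fun q' hq' => ?_
        obtain ⟨hne, hq'C⟩ := Finset.mem_erase.mp hq'
        by_cases hsub : F q ⊆ F q'
        · have hne' : F q ≠ F q' := fun h => hne (hFinj q' hq'C q hq h.symm)
          have hlt : (F q).card < (F q').card := Finset.card_lt_card (lt_of_le_of_ne hsub hne')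
          have := hle q' hq'C
          rw [ih (M - (F q').card) (by omega) q' hq'C rfl, zero_mul]
        · rw [if_neg hsub, mul_zero]
      rwa [hrest, add_zero] at h1
  have hκ0 : ∀ q ∈ C, κ q = 0 := fun q hq => key _ q hq rfl
  refine ⟨hκ0, ?_⟩
  have h1 := hν P₀ hP₀
  rw [if_pos rfl, mul_one, Finset.sum_eq_zero (fun q hq => by rw [hκ0 q hq, zero_mul]), zero_add] at h1
  exact h1

end BallDiag

end

end Summit.ValiantsHypothesis.ValiantsHypothesis.Theorems.BarrierLever.HiddenStates
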